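import Summits.BirchSwinnertonDyer.BirchSwinnertonDyer.Theorems.QuadraticBranchSignedControlEtaTransportPlusOfDecomposition
import Summits.BirchSwinnertonDyer.Rank1Residual.Additive.QuadraticBranchOddStrictSelmer
import Literature.NumberTheory.EllipticCurves.Kobayashi2003.SignedSelmerEtaComponentFacts
import HarnessLib

/-!
# Route `QuadraticBranchSignedControl` (rung K8, cell `bsd-potss`), crux `EtaTransportSigned`
# (item stmt-BirchSwinnertonDyer-19115): BOTH conjuncts of `EtaTransportSigned`, SPELLED OUT, from
# the decomposition frame `hdec` and the named fact — in a module importing NO `Theses.*` file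
# (planner bsd-potss-plan g11 ASK, INBOX 2026-08-26T05:37Z; for tenure rev 9's inline `closes`)

WHAT. `etaTransportSignedPair_of_decomposition_of_thm74Fact (hdec) (h74) : (plus) ∧ (minus)`:
the plus conjunct is `etaTransportPlus_of_decomposition hdec` (module
`…EtaTransportPlusOfDecomposition`, header revised to be `Theses`-free); the minus conjunct is
Kobayashi's Thm. 7.4 (ii) ⟹ (iii) at `η` — the NAMED fact
`Literature.NumberTheory.EllipticCurves.Kobayashi2003.thm74_etaEvenMC_iff_etaOddMC` — applied to the
plus conjunct (the same bridge as the route-side `etaTransportMinus_of_plus_of_thm74Fact`, p422126,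
whose module imports the route file and therefore cannot be imported by it; the argument is inlined
here, not restated as a declaration). `hdec` has the SAME type as in p418003 / p422126.

HONEST FRAMING (cell `bsd-potss`, run/shared/lean/pub/bsd-potss/; FULL-BSD rank ≤ 1 programme):
TOOL THEOREM ONLY — no definition, no named fact minted, no `sorry`, axioms standard. CONDITIONAL on
the displayed frame `hdec` (WANTED; = the planner's new crux `EtaDecompositionFrame`) and on the
named fact (no `_holds`; Coleman maps + Kato's Euler system). Nothing is closed or booked;
`BSD(W, p)` is claimed for no pair; BSD is not proved by any of this. Seat `bsd-potss-k8q-c3`, g0.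

References: [Kobayashi2003] Thm. 7.4 (p. 13), §4 p. 8, Thm. 1.2 (p. 2); [Kato2004] Thm. 12.5;
[GreenbergLNM1716] §3.
-/

set_option autoImplicit false
set_option linter.dupNamespace false

noncomputable section

open scoped Classical MatrixGroups ModularForm

open CongruenceSubgroup Field WeierstrassCurve
open Literature.NumberTheory.EllipticCurves
open Literature.NumberTheory.EllipticCurves.ModularForms
open Literature.NumberTheory.GaloisRepresentations
open Summit.BirchSwinnertonDyer.Rank1Residual.Additive

namespace Summit.BirchSwinnertonDyer.BirchSwinnertonDyer.Theorems

/-- **Both conjuncts of `EtaTransportSigned` (spelled out) from the decomposition frame `hdec` and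
Kobayashi's Thm. 7.4 at `η` (NAMED fact).** Plus: `etaTransportPlus_of_decomposition hdec`. Minus:
given `S_η⁻`-data `D` and `L_η = X·L'`, the fact's consequent (iii) at `D` (bridged to the Literature
structure by its fields) gives `char(𝒳_η⁻) = (L')`; its antecedent (ii) is the plus conjunct at the
fact's binders. CONDITIONAL on `hdec` and `h74`.
[cite: Kobayashi2003, Thm. 7.4 (p. 13), §4 p. 8] -/
theorem etaTransportSignedPair_of_decomposition_of_thm74Fact
    (hdec : ∀ (p : ℕ) [Fact p.Prime], 5 ≤ p →
      ∀ (K₀ : Type) [Field K₀] [NumberField K₀] [IsCyclotomicExtension {p} ℚ K₀]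
        [(galRange (K := ℚ) K₀).Normal] (ηq : absoluteGaloisGroup ℚ →* ℤˣ),
        (∀ σ ∈ galRange (K := ℚ) K₀, ηq σ = 1) → ηq ≠ 1 →
      ∀ (V : WeierstrassCurve ℚ) [V.IsElliptic] [V.IsGloballyMinimal],
        V.HasGoodReductionAtPrime p → V.frobeniusTrace p = 0 →
      ∀ (κ : ZpExtension ℚ p) (γ : absoluteGaloisGroup ℚ),
        κ.IsCyclotomic → κ.IsTopGenerator γ → γ ∈ galRange (K := ℚ) K₀ →
        IsCyclotomicVariable p γ →
      ∃ (F : Type) (_ : Field F) (_ : NumberField F) (V' : WeierstrassCurve F) (_ : V'.IsElliptic)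
        (κF : ZpExtension F p) (γF : absoluteGaloisGroup F)
        (Φ : Kobayashi2003.signedSelmerInfty V' κF 1 ≃+
          Kobayashi2003.signedSelmerInfty V κ 1 × towerSignedSelmerInftyEta V κ K₀ ℚ_[p] ηq 1),
        Module.finrank ℚ F = 2 ∧ (∃ θ : F, θ ^ 2 = algebraMap ℚ F ((-1) ^ (p / 2) * p)) ∧
        (∃ C : VariableChange F, C • V.baseChange F = V') ∧
        κF.IsCyclotomic ∧ κF.IsTopGenerator γF ∧
        (∃ ζ : ℤ_[p]ˣ, IsOfFinOrder ζ ∧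
          ((GaloisRep.cyclotomicCharacter F p γF * ζ : ℤ_[p]ˣ) : ℤ_[p]) =
            (cyclotomicGenerator p : ℤ_[p])) ∧
        ∀ s : Kobayashi2003.signedSelmerInfty V' κF 1,
          ((Φ ⟨V'.conjH1 p κF.kerSubgroup γF s,
              Kobayashi2003.conjH1_mem_signedSelmerInfty V' κF 1 γF s.2⟩).1 : V.subgroupH1 p κ.kerSubgroup) =
            V.conjH1 p κ.kerSubgroup γ (Φ s).1 ∧
          ((Φ ⟨V'.conjH1 p κF.kerSubgroup γF s,
              Kobayashi2003.conjH1_mem_signedSelmerInfty V' κF 1 γF s.2⟩).2 :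
              V.subgroupH1 p (towerTopSubgroup κ K₀)) =
            V.conjH1 p (towerTopSubgroup κ K₀) γ (Φ s).2)
    (h74 : Kobayashi2003.thm74_etaEvenMC_iff_etaOddMC) :
    (∀ (p : ℕ) [Fact p.Prime], 5 ≤ p →
    ∀ (K₀ : Type) [Field K₀] [NumberField K₀] [IsCyclotomicExtension {p} ℚ K₀]
      [(galRange (K := ℚ) K₀).Normal] (ηq : absoluteGaloisGroup ℚ →* ℤˣ),
      (∀ σ ∈ galRange (K := ℚ) K₀, ηq σ = 1) → ηq ≠ 1 →
    ∀ (V : WeierstrassCurve ℚ) [V.IsElliptic] [V.IsGloballyMinimal] {N : ℕ} [NeZero N]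
      {f : CuspForm (Gamma0 N) 2},
      p ≠ 2 → V.HasGoodReductionAtPrime p → V.frobeniusTrace p = 0 →
      QuadraticBranchPlusMainConjectureAt V p → IsNewformOf V f →
    ∀ (ϖ : ℚ), (if Even (p / 2) then (ϖ : ℝ) * V.realPeriodRat = plusPeriod f
        else (ϖ : ℝ) * V.imaginaryPeriodRat = minusPeriod f) →
    ∀ (Lη : IwasawaAlgebra p), IsQuadraticBranchPlusLFunction f p ϖ Lη →
    ∀ (κ : ZpExtension ℚ p) (γ : absoluteGaloisGroup ℚ),
      κ.IsCyclotomic → κ.IsTopGenerator γ → γ ∈ galRange (K := ℚ) K₀ →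
      IsCyclotomicVariable p γ →
    ∀ (D : EtaSignedSelmerDualData V κ K₀ ℚ_[p] ηq γ 1),
      Module.Finite (IwasawaAlgebra p) D.X ∧ Module.IsTorsion (IwasawaAlgebra p) D.X ∧
        D.charIdeal = Ideal.span {Lη}) ∧
    (∀ (p : ℕ) [Fact p.Prime], 5 ≤ p →
    ∀ (K₀ : Type) [Field K₀] [NumberField K₀] [IsCyclotomicExtension {p} ℚ K₀]
      [(galRange (K := ℚ) K₀).Normal] (ηq : absoluteGaloisGroup ℚ →* ℤˣ),
      (∀ σ ∈ galRange (K := ℚ) K₀, ηq σ = 1) → ηq ≠ 1 →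
    ∀ (V : WeierstrassCurve ℚ) [V.IsElliptic] [V.IsGloballyMinimal] {N : ℕ} [NeZero N]
      {f : CuspForm (Gamma0 N) 2},
      p ≠ 2 → V.HasGoodReductionAtPrime p → V.frobeniusTrace p = 0 →
      QuadraticBranchPlusMainConjectureAt V p → IsNewformOf V f →
    ∀ (ϖ : ℚ), (if Even (p / 2) then (ϖ : ℝ) * V.realPeriodRat = plusPeriod f
        else (ϖ : ℝ) * V.imaginaryPeriodRat = minusPeriod f) →
    ∀ (Lη : IwasawaAlgebra p), IsQuadraticBranchMinusLFunction f p ϖ Lη →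
    ∀ (κ : ZpExtension ℚ p) (γ : absoluteGaloisGroup ℚ),
      κ.IsCyclotomic → κ.IsTopGenerator γ → γ ∈ galRange (K := ℚ) K₀ →
      IsCyclotomicVariable p γ →
    ∀ (D : EtaSignedSelmerDualData V κ K₀ ℚ_[p] ηq γ (-1)) (L' : IwasawaAlgebra p),
      Lη = PowerSeries.X * L' → D.charIdeal = Ideal.span {L'}) := by
  have hplus : ∀ (p : ℕ) [Fact p.Prime], 5 ≤ p →
      ∀ (K₀ : Type) [Field K₀] [NumberField K₀] [IsCyclotomicExtension {p} ℚ K₀]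
        [(galRange (K := ℚ) K₀).Normal] (ηq : absoluteGaloisGroup ℚ →* ℤˣ),
        (∀ σ ∈ galRange (K := ℚ) K₀, ηq σ = 1) → ηq ≠ 1 →
      ∀ (V : WeierstrassCurve ℚ) [V.IsElliptic] [V.IsGloballyMinimal] {N : ℕ} [NeZero N]
        {f : CuspForm (Gamma0 N) 2},
        p ≠ 2 → V.HasGoodReductionAtPrime p → V.frobeniusTrace p = 0 →
        QuadraticBranchPlusMainConjectureAt V p → IsNewformOf V f →
      ∀ (ϖ : ℚ), (if Even (p / 2) then (ϖ : ℝ) * V.realPeriodRat = plusPeriod f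
          else (ϖ : ℝ) * V.imaginaryPeriodRat = minusPeriod f) →
      ∀ (Lη : IwasawaAlgebra p), IsQuadraticBranchPlusLFunction f p ϖ Lη →
      ∀ (κ : ZpExtension ℚ p) (γ : absoluteGaloisGroup ℚ),
        κ.IsCyclotomic → κ.IsTopGenerator γ → γ ∈ galRange (K := ℚ) K₀ →
        IsCyclotomicVariable p γ →
      ∀ (D : EtaSignedSelmerDualData V κ K₀ ℚ_[p] ηq γ 1),
        Module.Finite (IwasawaAlgebra p) D.X ∧ Module.IsTorsion (IwasawaAlgebra p) D.X ∧
          D.charIdeal = Ideal.span {Lη} :=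
    etaTransportPlus_of_decomposition hdec
  refine ⟨hplus, ?_⟩
  intro p _ hp5 K₀ _ _ _ _ ηq hηK hη1 V _ _ N _ f hp2 hgood hap h1 hf ϖ hϖ Lη hL κ γ hκ hγ hγK hγc D L'
    hLL'
  -- the even main conjecture at `η`, for every plus function and every (Literature-copy) plus datum
  have heven : ∀ (Lp : IwasawaAlgebra p), Kobayashi2003.IsQuadraticBranchPlusLFunction f p ϖ Lp →
      ∀ D' : Kobayashi2003.EtaSignedSelmerDualData V κ K₀ ℚ_[p] ηq γ 1,
        D'.charIdeal = Ideal.span {Lp} := by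
    intro Lp hLp D'
    let Dp : EtaSignedSelmerDualData V κ K₀ ℚ_[p] ηq γ 1 :=
      { X := D'.X
        conj_mem := D'.conj_mem
        toDual := D'.toDual
        bijective := D'.bijective
        toDual_T_smul := D'.toDual_T_smul
        toDual_C_smul := D'.toDual_C_smul }
    exact (hplus p hp5 K₀ ηq hηK hη1 V hp2 hgood hap h1 hf ϖ hϖ Lp hLp κ γ hκ hγ hγK hγc Dp).2.2
  -- Thm. 7.4 at `η`: even ⟹ odd, read back on the Summits datum `D`
  let D' : Kobayashi2003.EtaSignedSelmerDualData V κ K₀ ℚ_[p] ηq γ (-1) :=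
    { X := D.X
      conj_mem := D.conj_mem
      toDual := D.toDual
      bijective := D.bijective
      toDual_T_smul := D.toDual_T_smul
      toDual_C_smul := D.toDual_C_smul }
  exact (h74 p K₀ ηq hηK hη1 V hp2 hgood hap hf ϖ hϖ κ γ hκ hγ hγK hγc).mp heven Lη hL D' L' hLL'


end Summit.BirchSwinnertonDyer.BirchSwinnertonDyer.Theorems

end
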